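import Literature.Geometry.Kaehler.ChernCharacterProofs
import HarnessLib

/-!
# Words in three matrices of `2`-forms: expansion of `(X₀ + tX₁ + t²X₂)ᵖ`, cyclic trace

Layer `Literature/Geometry/Kaehler`. Algebraic support for the discharge of Chern–Weil II
(`SmoothComplexVectorBundle.mk_eq_mk_of_isChernCharacterForm`, `ChernCharacter.lean`), i.e. for
Kobayashi's formula (2.10) `dφ = f(Ω₁) − f(Ω₀)` with `φ = k ∫₀¹ f(α, Ω_t, …, Ω_t) dt`
(*Differential Geometry of Complex Vector Bundles* (1987), Ch. II §2). Along the line of connections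
`ω_t = ω₀ + tα` the curvature is a polynomial of degree `2` in `t`,
`Ω_t = Ω₀ + tA + t²B` (`A = dα + α ∧ ω₀ + ω₀ ∧ α`, `B = α ∧ α`, (2.7)), so `Ω_tᵖ` and
`α ∧ Ω_tᵖ` are polynomials in `t` whose coefficients are sums of WORDS `X_{e₀} ∧ ⋯ ∧ X_{e_{p−1}}`
in `X₀ = Ω₀, X₁ = A, X₂ = B`; integrating these polynomials coefficientwise (`∫₀¹ tᵐ dt = 1/(m+1)`)
makes the transgression form `φ` explicit and reduces the key step
`(d/dt) f(Ω_t, …, Ω_t) = k f(dΩ_t/dt, Ω_t, …, Ω_t)` (p. 34) to the cyclic invariance of the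
trace of a word under rotation of its letters. This file provides, for matrices of forms on any
real manifold (`MatrixFormAlgebra`):

* `MatrixForm.word X m e` — the word `X_{e₀} ∧ ⋯ ∧ X_{e_{m−1}}` of the letters
  `X : Fin 3 → MatrixForm I M r 2` spelled by `e : Fin m → Fin 3` (snoc recursion, as `npow`), and
  its weight `wordWt e = Σ_j e_j` (the power of `t` it carries);
* `MatrixForm.npow_sum_pow_smul` — **the expansion**
  `(Σ_c tᶜ X_c)ᵐ = Σ_{e : Fin m → Fin 3} t^{wt e} word X m e`;
* `MatrixForm.word_succ_eq_cons` — the cons description `word (e) = X_{e₀} ∧ word (tail e)`;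
* `MatrixForm.trace_word_comp_finRotate` — **cyclic invariance** `tr(word (e ∘ rot)) = tr(word e)`
  (graded cyclicity of the trace, all letters having even degree);
* `MatrixForm.sum_wordWt_smul_eq` — the counting identity
  `Σ_e (wt e) • f e = (m+1) • Σ_e e_{last} • f e` for every rotation-invariant `f` (each position
  carries the same total weight), which is the combinatorial content of
  `(d/dt) tr(Ω_tᵏ) = k tr((dΩ_t/dt) ∧ Ω_tᵏ⁻¹)`.

## References

* S. Kobayashi, *Differential Geometry of Complex Vector Bundles* (1987), Ch. II §2 (2.5)–(2.10).
-/

noncomputable section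

open scoped Manifold ContDiff Topology Matrix
open Set

namespace Literature.Geometry.Kaehler

namespace MatrixForm

variable {E : Type*} [NormedAddCommGroup E] [NormedSpace ℝ E]
  {H : Type*} [TopologicalSpace H] {I : ModelWithCorners ℝ E H}
  {M : Type*} [TopologicalSpace M] [ChartedSpace H M] {r k l : ℕ}

/-! ### Sums through the matrix wedge and casts -/

/-- The matrix wedge distributes over finite sums on the left. [cite: Kobayashi1987, Ch. I §1] -/
theorem sum_wedge {κ : Type*} (s : Finset κ) (A : κ → MatrixForm I M r k) (B : MatrixForm I M r l) :
    (∑ i ∈ s, A i).wedge B = ∑ i ∈ s, (A i).wedge B := by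
  classical
  induction s using Finset.induction_on with
  | empty => rw [Finset.sum_empty, Finset.sum_empty, zero_wedge]
  | insert i s hi ih => rw [Finset.sum_insert hi, Finset.sum_insert hi, add_wedge, ih]

/-- The matrix wedge distributes over finite sums on the right. [cite: Kobayashi1987, Ch. I §1] -/
theorem wedge_sum {κ : Type*} (s : Finset κ) (A : MatrixForm I M r k) (B : κ → MatrixForm I M r l) :
    A.wedge (∑ i ∈ s, B i) = ∑ i ∈ s, A.wedge (B i) := by
  classical
  induction s using Finset.induction_on with
  | empty => rw [Finset.sum_empty, Finset.sum_empty, wedge_zero]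
  | insert i s hi ih => rw [Finset.sum_insert hi, Finset.sum_insert hi, wedge_add, ih]

/-- Degree casts commute with finite sums. [folklore] -/
theorem castDeg_sum {κ : Type*} {k' : ℕ} (s : Finset κ) (h : k = k') (A : κ → MatrixForm I M r k) :
    (∑ i ∈ s, A i).castDeg h = ∑ i ∈ s, (A i).castDeg h := by
  subst h; simp only [castDeg_rfl]

/-- The trace commutes with finite sums of matrices of forms. [folklore] -/
theorem trace_sum {κ : Type*} (s : Finset κ) (A : κ → MatrixForm I M r k) :
    (∑ i ∈ s, A i).trace = ∑ i ∈ s, (A i).trace :=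
  map_sum (Matrix.traceAddMonoidHom (Fin r) (MForm I M ℂ k)) A s

/-- The trace commutes with real scalars. [folklore] -/
theorem trace_smul (c : ℝ) (A : MatrixForm I M r k) : (c • A).trace = c • A.trace :=
  Matrix.trace_smul c A

/-! ### Words -/

/-- The **weight** `wt e = Σ_j e_j` of a word `e : Fin m → Fin 3`: the power of `t` carried by the
word `X_{e₀} ∧ ⋯ ∧ X_{e_{m−1}}` in the expansion of `(X₀ + tX₁ + t²X₂)ᵐ`. [folklore] -/
def wordWt {m : ℕ} (e : Fin m → Fin 3) : ℕ := ∑ j, (e j : ℕ)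

/-- The weight of a word of length `m + 1` splits off its last letter. [folklore] -/
theorem wordWt_succ {m : ℕ} (e : Fin (m + 1) → Fin 3) :
    wordWt e = wordWt (Fin.init e) + (e (Fin.last m) : ℕ) := by
  rw [wordWt, wordWt, Fin.sum_univ_castSucc]
  rfl

/-- The weight of a snoc word. [folklore] -/
theorem wordWt_snoc {m : ℕ} (e : Fin m → Fin 3) (c : Fin 3) :
    wordWt (Fin.snoc e c : Fin (m + 1) → Fin 3) = wordWt e + (c : ℕ) := by
  rw [wordWt_succ, Fin.init_snoc, Fin.snoc_last]

/-- The weight is invariant under rotation of the word. [folklore] -/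
theorem wordWt_comp_finRotate {m : ℕ} (e : Fin (m + 1) → Fin 3) :
    wordWt (e ∘ finRotate (m + 1)) = wordWt e := by
  simp only [wordWt, Function.comp_apply]
  exact Equiv.sum_comp (finRotate (m + 1)) (fun j ↦ (e j : ℕ))

/-- The **word** `X_{e₀} ∧ X_{e₁} ∧ ⋯ ∧ X_{e_{m−1}}` in three matrices of `2`-forms `X₀, X₁, X₂`
spelled by `e : Fin m → Fin 3`, a matrix of `2m`-forms (snoc recursion with the same degree cast as
`npow`; the empty word is `1`). These are the coefficients of the powers of the polynomial curvature
`Ω_t = Ω₀ + tA + t²B` along a line of connections (Kobayashi (2.7)). [cite: Kobayashi1987, Ch. II §2 (2.7)] -/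
def word (X : Fin 3 → MatrixForm I M r 2) : (m : ℕ) → (Fin m → Fin 3) → MatrixForm I M r (2 * m)
  | 0, _ => one
  | m + 1, e => ((word X m (Fin.init e)).wedge (X (e (Fin.last m)))).castDeg (by omega)

/-- The empty word is `1` (definitional). [folklore] -/
@[simp]
theorem word_zero (X : Fin 3 → MatrixForm I M r 2) (e : Fin 0 → Fin 3) : word X 0 e = one :=
  rfl

/-- The snoc step of `word` (definitional). [folklore] -/
theorem word_succ (X : Fin 3 → MatrixForm I M r 2) {m : ℕ} (e : Fin (m + 1) → Fin 3) :
    word X (m + 1) e =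
      ((word X m (Fin.init e)).wedge (X (e (Fin.last m)))).castDeg (by omega) :=
  rfl

/-- The word of a snoc. [folklore] -/
theorem word_snoc (X : Fin 3 → MatrixForm I M r 2) {m : ℕ} (e : Fin m → Fin 3) (c : Fin 3) :
    word X (m + 1) (Fin.snoc e c) = ((word X m e).wedge (X c)).castDeg (by omega) := by
  rw [word_succ, Fin.init_snoc, Fin.snoc_last]

/-! ### The expansion of `(X₀ + tX₁ + t²X₂)ᵐ` -/

/-- **Expansion of the powers of a polynomial matrix of `2`-forms**: for real `t`,
`(Σ_c tᶜ X_c)ᵐ = Σ_{e : Fin m → Fin 3} t^{wt e} • word X m e` (multiply out; the last letter of a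
word of length `m + 1` indexes the factor taken from the last copy of the sum). Applied to
`Ω_t = Ω₀ + tA + t²B` this expands `Ω_tᵐ` along the line of connections (2.5)–(2.7).
[cite: Kobayashi1987, Ch. II §2 (2.7)] -/
theorem npow_sum_pow_smul (X : Fin 3 → MatrixForm I M r 2) (t : ℝ) (m : ℕ) :
    npow (∑ c : Fin 3, (t ^ (c : ℕ)) • X c) m = ∑ e : Fin m → Fin 3, (t ^ wordWt e) • word X m e := by
  induction m with
  | zero =>
    rw [npow_zero, Fintype.sum_unique]
    simp [wordWt]
  | succ m ih =>
    rw [npow_succ, ih, sum_wedge, castDeg_sum,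
      ← (Fin.snocEquiv fun _ : Fin (m + 1) ↦ Fin 3).sum_comp, Fintype.sum_prod_type, Finset.sum_comm]
    refine Finset.sum_congr rfl fun e _ ↦ ?_
    rw [wedge_sum, castDeg_sum]
    refine Finset.sum_congr rfl fun c _ ↦ ?_
    have hsnoc : (Fin.snocEquiv fun _ : Fin (m + 1) ↦ Fin 3) (c, e) = Fin.snoc e c := rfl
    rw [hsnoc, smul_wedge, wedge_smul, smul_smul, ← pow_add, castDeg_smul, word_snoc, wordWt_snoc]

/-! ### The cons description and the cyclic trace -/

/-- **The cons description of a word**: `word (m+1) e = X_{e₀} ∧ word m (tail e)` up to the cast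
along `2 + 2m = 2(m+1)` (associativity of the matrix wedge). [folklore] -/
theorem word_succ_eq_cons (X : Fin 3 → MatrixForm I M r 2) :
    ∀ (m : ℕ) (e : Fin (m + 1) → Fin 3),
      word X (m + 1) e = ((X (e 0)).wedge (word X m (Fin.tail e))).castDeg (by omega)
  | 0, e => by
    rw [word_succ, word_zero, word_zero, one_wedge, wedge_one, castDeg_castDeg]
    rfl
  | m + 1, e => by
    rw [word_succ, word_succ_eq_cons X m (Fin.init e), word_succ X (Fin.tail e), castDeg_wedge,
      wedge_assoc, castDeg_castDeg, castDeg_castDeg, wedge_castDeg, castDeg_castDeg,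
      Fin.tail_init_eq_init_tail]
    rfl

/-- Rotating a word to the left is snoc-ing its first letter to its tail. [folklore] -/
theorem comp_finRotate_eq_snoc {m : ℕ} (e : Fin (m + 1) → Fin 3) :
    e ∘ finRotate (m + 1) = Fin.snoc (Fin.tail e) (e 0) := by
  rw [Fin.snoc_eq_cons_rotate, Fin.cons_self_tail]
  rfl

/-- **Cyclic invariance of the trace of a word**: `tr(word (e ∘ rot)) = tr(word e)` for the left
rotation `rot = finRotate (m+1)` — `tr(W ∧ X) = tr(X ∧ W)` for matrices of forms of even degrees
(`trace_wedge_comm`). This is the step "`f` is `GL(r; ℂ)`-invariant and symmetric" of Kobayashi's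
argument for `f(X₁, …, X_k) = tr(X₁ ⋯ X_k)` symmetrised. [cite: Kobayashi1987, Ch. II §2 (2.2)] -/
theorem trace_word_comp_finRotate (X : Fin 3 → MatrixForm I M r 2) {m : ℕ} (e : Fin (m + 1) → Fin 3) :
    (word X (m + 1) (e ∘ finRotate (m + 1))).trace = (word X (m + 1) e).trace := by
  rw [comp_finRotate_eq_snoc, word_snoc, word_succ_eq_cons X m e, trace_castDeg, trace_castDeg,
    trace_wedge_comm (X (e 0)) (word X m (Fin.tail e)), MForm.castDeg_smul, MForm.castDeg_castDeg,
    show ((-1 : ℝ) ^ (2 * (2 * m))) = 1 by rw [pow_mul, neg_one_sq, one_pow], one_smul]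

/-! ### The counting identity -/

/-- For a rotation-invariant weight function `f` on words, every position carries the same total:
`Σ_e e_j • f e = Σ_e e_0 • f e`. [folklore] -/
theorem sum_apply_smul_eq_sum_apply_zero_smul {N : Type*} [AddCommMonoid N] [Module ℝ N] {m : ℕ}
    (f : (Fin (m + 1) → Fin 3) → N) (hf : ∀ e, f (e ∘ finRotate (m + 1)) = f e) (j : Fin (m + 1)) :
    ∑ e : Fin (m + 1) → Fin 3, ((e j : ℕ) : ℝ) • f e = ∑ e : Fin (m + 1) → Fin 3, ((e 0 : ℕ) : ℝ) • f e := by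
  induction j using Fin.induction with
  | zero => rfl
  | succ j ih =>
    rw [← ih]
    -- reindex by the rotation: `e ↦ e ∘ rot`, `(e ∘ rot) (castSucc j) = e (succ j)`
    have hbij : Function.Bijective fun e : Fin (m + 1) → Fin 3 ↦ e ∘ finRotate (m + 1) :=
      (Equiv.arrowCongr (finRotate (m + 1)) (Equiv.refl (Fin 3))).symm.bijective
    rw [← hbij.sum_comp fun e ↦ ((e (Fin.castSucc j) : ℕ) : ℝ) • f e]
    refine Finset.sum_congr rfl fun e _ ↦ ?_
    simp only [Function.comp_apply, hf]
    congr 3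
    rw [finRotate_apply, Fin.coeSucc_eq_succ]

/-- **The counting identity**: for a rotation-invariant `f`,
`Σ_e (wt e) • f e = (m + 1) • Σ_e e_{last} • f e` (sum the previous lemma over the `m + 1`
positions). With `f e = t^{wt e − 1} tr(word e)` this is
`(d/dt) tr(Ω_tᵐ⁺¹) = (m+1) tr((dΩ_t/dt) ∧ Ω_tᵐ)` along `Ω_t = Ω₀ + tA + t²B`, Kobayashi's
`(d/dt) f(Ω_t, …, Ω_t) = k f(dΩ_t/dt, Ω_t, …, Ω_t)`. [cite: Kobayashi1987, Ch. II §2 (2.8)–(2.10)] -/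
theorem sum_wordWt_smul_eq {N : Type*} [AddCommMonoid N] [Module ℝ N] {m : ℕ}
    (f : (Fin (m + 1) → Fin 3) → N) (hf : ∀ e, f (e ∘ finRotate (m + 1)) = f e) :
    ∑ e : Fin (m + 1) → Fin 3, (wordWt e : ℝ) • f e =
      ((m + 1 : ℕ) : ℝ) • ∑ e : Fin (m + 1) → Fin 3, ((e (Fin.last m) : ℕ) : ℝ) • f e := by
  have h : ∀ e : Fin (m + 1) → Fin 3, (wordWt e : ℝ) • f e = ∑ j, ((e j : ℕ) : ℝ) • f e := fun e ↦ by
    rw [wordWt, Nat.cast_sum, Finset.sum_smul]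
  simp only [h]
  rw [Finset.sum_comm, Finset.sum_congr rfl fun j _ ↦ sum_apply_smul_eq_sum_apply_zero_smul f hf j,
    Finset.sum_const, Finset.card_univ, Fintype.card_fin, ← Nat.cast_smul_eq_nsmul ℝ,
    sum_apply_smul_eq_sum_apply_zero_smul f hf (Fin.last m)]

end MatrixForm

end Literature.Geometry.Kaehler

end
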